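import Mathlib
import HarnessLib
import Summits.FinalStateConjecture.Statement

/-!
# Route ProbeNullTrace — the Assembly, frame form (items stmt-FinalStateConjecture-17472 / ex-9966)

The assembly item of route `ProbeNullTrace` for the Final State Conjecture is, since the route repair
rev 4 of 2026-08-16T23:19Z (after the summit re-type p126844: TAME Christodoulou genericity on one fixed
end, `RaysStayInClosure`, honest radii, `IsFutureOriented`),
`CensorshipTraceNull → SettlingTraceNull → AdmissibleMGHDExists → LinePiercing → TameSegmentToCurve →
FinalStateConjecture` (item stmt-FinalStateConjecture-17472), i.e. literally the type of the route
file's sorry-free deciding theorem `Summit.FinalStateConjecture.FinalStateConjecture.Theses.ProbeNullTrace.closes`.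

Design constraint (why this file does NOT import the route module
`Summits.FinalStateConjecture.FinalStateConjecture.Theses.ProbeNullTrace`): when an item closes,
the gate re-renders the route file, historically with `import <closing module>` and
`theorem Assembly_holds : Assembly := …`; a closing module that itself imports the route module
made that render cyclic (three episodes on this summit: PhotonSphereChannels rev 4, SwallowTheDatum
rev 4, EIHFluxBalance rev 4, each needing a route repair). So the theorem below is stated with the
five hypotheses INLINED VERBATIM (the bodies of `CensorshipTraceNull`, `SettlingTraceNull`,
`AdmissibleMGHDExists`, `LinePiercing`, `TameSegmentToCurve`, copied byte-for-byte from the route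
file rev 5), so that its type is, by `δ`-unfolding those five definitions only, the route decl
`Summit.FinalStateConjecture.FinalStateConjecture.Theses.ProbeNullTrace.Assembly`, and the route
file can import this module without a cycle (pattern `Theorems/EIHFluxBalanceAssemblyTameFrame.lean`).

The proof is pure logic, the same as the deciding theorem `closes`: fix `X` and an admissible
datum `D` exceptional for the Statement's property; `AdmissibleMGHDExists` gives an MGHD, so `D`
fails the universal clause "every MGHD has complete `𝓘⁺` and settles (sub-extremal Kerrs,
`O = exteriorOf`, `RaysStayInClosure`, `HasExhaustiveCharts`, `IsFutureOriented`)"; either some MGHD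
has incomplete future null infinity (apply `CensorshipTraceNull`) or all are complete and one fails
to settle (apply `SettlingTraceNull`); either way there is an end `e` and a tame (on `e`), immersed,
injective admissible `k`-probe `Φ` through `D` (`k ≥ 2`) whose punctured exceptional trace near `0`
lies in a `μH[k-1]`-null set plus finitely many walls; `LinePiercing` (with `T` := the parameters at
which `Φ` fails the universal clause) gives a direction `θ ≠ 0` and `ε > 0` with `Φ (t • θ)`
satisfying the universal clause for `0 < |t| < ε`; those data are admissible, hence (by
`AdmissibleMGHDExists`) have an MGHD, hence are NOT exceptional; and `TameSegmentToCurve`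
reparametrises the punctured segment to the tame (same end `e`), immersed, injective one-parameter
admissible family through `Φ 0 = D` that `IsTameChristodoulouGeneric (admissibleVacuumData X) _ 1`
asks for. No analysis, no new definitions, nothing restated as a fact.

**Repair 2026-08-17 (full builds of 2026-08-16T23:32Z / 2026-08-17T00:13Z, "143:27 / 160:9
Application type mismatch").** The landed theorem `ProbeNullTrace.assembly_frame_proof` proved the
rev-3 assembly (item stmt-FinalStateConjecture-9966, closed `proved` by it, REPLACED at rev 4 by
stmt-17472): it inlined the rev-3 bodies (smooth probes `IsSmoothDataFamily`, settled clause without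
`RaysStayInClosure`/`IsFutureOriented`, `SegmentToCurve`) and concluded the then summit statement over
`IsChristodoulouGeneric`. Its TYPE still elaborates against the re-typed Statement but is no longer
provable from its own hypotheses (data failing only the new clauses are covered by neither trace
hypothesis, and the conclusion now demands tame immersed families), so the proof cannot be repaired
in place; Theorems files being append-only ("deprecate, don't mutate"), the name is kept as a
deprecated alias of the tame frame proof `ProbeNullTrace.assembly_tame_frame_proof` below, which
proves the CURRENT assembly stmt-17472 with the current bodies inlined.
-/

-- the summit-side namespace `Summit.FinalStateConjecture.FinalStateConjecture.…` is mandated (D-0022)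
set_option linter.dupNamespace false

namespace Summit.FinalStateConjecture.FinalStateConjecture.Theorems

open scoped BigOperators Topology Manifold Classical MeasureTheory ProbabilityTheory Matrix InnerProductSpace ComplexConjugate ContinuousMap
open Filter Set Function TopologicalSpace MeasureTheory

/-- **Assembly of route ProbeNullTrace, tame frame form** (item stmt-FinalStateConjecture-17472):
`C → S → M → L → R → FinalStateConjecture` with
C = `CensorshipTraceNull` (stmt-17470: an admissible datum with an MGHD of incomplete future null
infinity is the centre of a tame (one end `e`), immersed-at-`0`, injective admissible `k`-probe,
`k ≥ 2`, whose punctured exceptional trace near `0` — exceptional for "all MGHDs have complete `𝓘⁺`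
and settle to finitely many sub-extremal Kerrs with `O = exteriorOf`, `RaysStayInClosure`,
`HasExhaustiveCharts`, `IsFutureOriented`" — lies in a `μH[k-1]`-null set plus finitely many zero
sets of functions differentiable at `0` with non-zero differential), S = `SettlingTraceNull`
(stmt-17471: the same for admissible data all of whose MGHDs have complete `𝓘⁺` but one of which does
not settle), M = `AdmissibleMGHDExists` (stmt-9937: every admissible datum has an MGHD),
L = `LinePiercing` (stmt-9964, proved: null dust plus finitely many walls in `ℝᵏ` miss a punctured
segment through `0`) and R = `TameSegmentToCurve` (stmt-17473: a good punctured segment of a tame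
immersed injective probe reparametrises to a tame immersed injective one-parameter admissible family
on the same end), all five written out verbatim (route file rev 5) so that this type unfolds to the
route decl `Summit.FinalStateConjecture.FinalStateConjecture.Theses.ProbeNullTrace.Assembly` by
`δ`-reduction alone. Proof: the pure-logic assembly described in the module docstring (identical to
the route's deciding theorem `Theses.ProbeNullTrace.closes`). -/
theorem ProbeNullTrace.assembly_tame_frame_proof :
    -- C = `CensorshipTraceNull` (item stmt-FinalStateConjecture-17470, crux)
    (∀ (X : Type) [TopologicalSpace X] [ChartedSpace Literature.Geometry.Lorentzian.E3 X] [IsManifold (𝓡 3) ((⊤ : ℕ∞) : WithTop ℕ∞) X] [T2Space X] [SecondCountableTopology X] [ConnectedSpace X], ∀ D ∈ Literature.Geometry.Lorentzian.admissibleVacuumData X, (∃ 𝒟 : Literature.Geometry.Lorentzian.VacuumCauchyDevelopment D, 𝒟.IsMaximal ∧ ¬ Summit.FinalStateConjecture.HasCompleteNullInfinity 𝒟.toCauchyDevelopment) → ∃ (e : Literature.Geometry.Lorentzian.AFEnd X) (k : ℕ) (Φ : EuclideanSpace ℝ (Fin k) → Literature.Geometry.Lorentzian.InitialDataSet (𝓡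 3) X), 2 ≤ k ∧ Literature.Geometry.Lorentzian.InitialDataSet.IsTameDataFamily e k Φ ∧ Literature.Geometry.Lorentzian.InitialDataSet.IsImmersedAtZero k Φ ∧ Function.Injective Φ ∧ Φ 0 = D ∧ (∀ c, Φ c ∈ Literature.Geometry.Lorentzian.admissibleVacuumData X) ∧ ∃ (δ : ℝ) (N : Set (EuclideanSpace ℝ (Fin k))) (m : ℕ) (g : Fin m → EuclideanSpace ℝ (Fin k) → ℝ) (L : Fin m → (EuclideanSpace ℝ (Fin k) →L[ℝ] ℝ)), 0 < δ ∧ μH[(k : ℝ) - 1] N = 0 ∧ (∀ i, HasFDerivAt (g i) (L i) 0 ∧ L i ≠ 0) ∧ ∀ c, ‖c‖ < δ → c ≠ 0 → ¬ (∀ 𝒟 : Literature.Geometry.Lorentzian.VacuumCauchyDevelopment (Φ c), 𝒟.IsMaximal → Summit.FinalStateConjecture.HasCompleteNullInfinity 𝒟.toCauchyDevelopment ∧ ∃ (O : Set 𝒟.carrier) (d : Literature.Geometry.Lorentzian.FinalStateDecomposition 𝒟.toSpacetime O 2), (∀ i, Literature.Geometry.Lorentzian.Kerr.IsSubextremal (d.mass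 i) (d.spin i)) ∧ O = Summit.FinalStateConjecture.exteriorOf 𝒟.toCauchyDevelopment d.charted ∧ Summit.FinalStateConjecture.RaysStayInClosure 𝒟.toCauchyDevelopment O ∧ Summit.FinalStateConjecture.HasExhaustiveCharts d ∧ Summit.FinalStateConjecture.IsFutureOriented d) → c ∈ N ∨ ∃ i, g i c = 0) →
    -- S = `SettlingTraceNull` (item stmt-FinalStateConjecture-17471, crux)
    (∀ (X : Type) [TopologicalSpace X] [ChartedSpace Literature.Geometry.Lorentzian.E3 X] [IsManifold (𝓡 3) ((⊤ : ℕ∞) : WithTop ℕ∞) X] [T2Space X] [SecondCountableTopology X] [ConnectedSpace X], ∀ D ∈ Literature.Geometry.Lorentzian.admissibleVacuumData X, (∀ 𝒟 : Literature.Geometry.Lorentzian.VacuumCauchyDevelopment D, 𝒟.IsMaximal → Summit.FinalStateConjecture.HasCompleteNullInfinity 𝒟.toCauchyDevelopment) → (∃ 𝒟 : Literature.Geometry.Lorentzian.VacuumCauchyDevelopment D, 𝒟.IsMaximal ∧ ¬ ∃ (O : Set 𝒟.carrier) (d : Literature.Geometry.Lorentzian.FinalStateDecomposition 𝒟.toSpacetime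 O 2), (∀ i, Literature.Geometry.Lorentzian.Kerr.IsSubextremal (d.mass i) (d.spin i)) ∧ O = Summit.FinalStateConjecture.exteriorOf 𝒟.toCauchyDevelopment d.charted ∧ Summit.FinalStateConjecture.RaysStayInClosure 𝒟.toCauchyDevelopment O ∧ Summit.FinalStateConjecture.HasExhaustiveCharts d ∧ Summit.FinalStateConjecture.IsFutureOriented d) → ∃ (e : Literature.Geometry.Lorentzian.AFEnd X) (k : ℕ) (Φ : EuclideanSpace ℝ (Fin k) → Literature.Geometry.Lorentzian.InitialDataSet (𝓡 3) X), 2 ≤ k ∧ Literature.Geometry.Lorentzian.InitialDataSet.IsTameDataFamily e k Φ ∧ Literature.Geometry.Lorentzian.InitialDataSet.IsImmersedAtZero k Φ ∧ Function.Injective Φ ∧ Φ 0 = D ∧ (∀ c, Φ c ∈ Literature.Geometry.Lorentzian.admissibleVacuumData X) ∧ ∃ (δ : ℝ) (N : Set (EuclideanSpace ℝ (Fin k))) (m : ℕ) (g : Fin m → EuclideanSpace ℝ (Fin k) → ℝ) (L : Fin m → (EuclideanSpace ℝ (Fin k) →L[ℝ] ℝ)), 0 < δ ∧ μH[(k : ℝ)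 - 1] N = 0 ∧ (∀ i, HasFDerivAt (g i) (L i) 0 ∧ L i ≠ 0) ∧ ∀ c, ‖c‖ < δ → c ≠ 0 → ¬ (∀ 𝒟 : Literature.Geometry.Lorentzian.VacuumCauchyDevelopment (Φ c), 𝒟.IsMaximal → Summit.FinalStateConjecture.HasCompleteNullInfinity 𝒟.toCauchyDevelopment ∧ ∃ (O : Set 𝒟.carrier) (d : Literature.Geometry.Lorentzian.FinalStateDecomposition 𝒟.toSpacetime O 2), (∀ i, Literature.Geometry.Lorentzian.Kerr.IsSubextremal (d.mass i) (d.spin i)) ∧ O = Summit.FinalStateConjecture.exteriorOf 𝒟.toCauchyDevelopment d.charted ∧ Summit.FinalStateConjecture.RaysStayInClosure 𝒟.toCauchyDevelopment O ∧ Summit.FinalStateConjecture.HasExhaustiveCharts d ∧ Summit.FinalStateConjecture.IsFutureOriented d) → c ∈ N ∨ ∃ i, g i c = 0) →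
    -- M = `AdmissibleMGHDExists` (item stmt-FinalStateConjecture-9937, crux)
    (∀ (X : Type) [TopologicalSpace X] [ChartedSpace Literature.Geometry.Lorentzian.E3 X] [IsManifold (𝓡 3) ((⊤ : ℕ∞) : WithTop ℕ∞) X] [T2Space X] [SecondCountableTopology X] [ConnectedSpace X], ∀ D ∈ Literature.Geometry.Lorentzian.admissibleVacuumData X, ∃ 𝒟 : Literature.Geometry.Lorentzian.VacuumCauchyDevelopment D, 𝒟.IsMaximal) →
    -- L = `LinePiercing` (item stmt-FinalStateConjecture-9964, support, proved)
    (∀ (k : ℕ), 2 ≤ k → ∀ (T N : Set (EuclideanSpace ℝ (Fin k))) (δ : ℝ) (m : ℕ) (g : Fin m → EuclideanSpace ℝ (Fin k) → ℝ) (L : Fin m → (EuclideanSpace ℝ (Fin k) →L[ℝ] ℝ)), 0 < δ → μH[(k : ℝ) - 1] N = 0 → (∀ i, HasFDerivAt (g i) (L i) 0 ∧ L i ≠ 0) → (∀ c ∈ T, ‖c‖ < δ → c ≠ 0 → c ∈ N ∨ ∃ i, g i c = 0) → ∃ θ : EuclideanSpace ℝ (Fin k), θ ≠ 0 ∧ ∃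 ε : ℝ, 0 < ε ∧ ∀ t : ℝ, t ≠ 0 → |t| < ε → t • θ ∉ T) →
    -- R = `TameSegmentToCurve` (item stmt-FinalStateConjecture-17473, crux)
    (∀ (X : Type) [TopologicalSpace X] [ChartedSpace Literature.Geometry.Lorentzian.E3 X] [IsManifold (𝓡 3) ((⊤ : ℕ∞) : WithTop ℕ∞) X] (𝓓 𝓔 : Set (Literature.Geometry.Lorentzian.InitialDataSet (𝓡 3) X)) (e : Literature.Geometry.Lorentzian.AFEnd X) (k : ℕ) (Φ : EuclideanSpace ℝ (Fin k) → Literature.Geometry.Lorentzian.InitialDataSet (𝓡 3) X) (θ : EuclideanSpace ℝ (Fin k)) (ε : ℝ), Literature.Geometry.Lorentzian.InitialDataSet.IsTameDataFamily e k Φ → Literature.Geometry.Lorentzian.InitialDataSet.IsImmersedAtZero k Φ → Function.Injective Φ → (∀ c, Φ c ∈ 𝓓) → θ ≠ 0 → 0 < ε → (∀ t : ℝ, t ≠ 0 → |t| < ε → Φ (t • θ) ∉ 𝓔) → ∃ F : EuclideanSpace ℝ (Fin 1) → Literature.Geometry.Lorentzian.InitialDataSet (𝓡 3) X, Literature.Geometry.Lorentzian.InitialDataSet.IsTameDataFamily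 e 1 F ∧ Literature.Geometry.Lorentzian.InitialDataSet.IsImmersedAtZero 1 F ∧ F 0 = Φ 0 ∧ Function.Injective F ∧ (∀ c, F c ∈ 𝓓) ∧ ∀ c, c ≠ 0 → F c ∉ 𝓔) →
    _root_.FinalStateConjecture := by
  intro h₁ h₂ h₃ h₄ h₅ X _ _ _ _ _ _ D hD
  obtain ⟨hDadm, hnotP⟩ := hD
  obtain ⟨𝒟₀, h𝒟₀⟩ := h₃ X D hDadm
  have key : ∃ (e : Literature.Geometry.Lorentzian.AFEnd X) (k : ℕ) (Φ : EuclideanSpace ℝ (Fin k) → Literature.Geometry.Lorentzian.InitialDataSet (𝓡 3) X), 2 ≤ k ∧ Literature.Geometry.Lorentzian.InitialDataSet.IsTameDataFamily e k Φ ∧ Literature.Geometry.Lorentzian.InitialDataSet.IsImmersedAtZero k Φ ∧ Function.Injective Φ ∧ Φ 0 = D ∧ (∀ c, Φ c ∈ Literature.Geometry.Lorentzian.admissibleVacuumData X) ∧ ∃ (δ : ℝ) (N : Set (EuclideanSpace ℝ (Fin k))) (m : ℕ) (g : Fin m → EuclideanSpace ℝ (Fin k) → ℝ) (L : Fin m →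 (EuclideanSpace ℝ (Fin k) →L[ℝ] ℝ)), 0 < δ ∧ μH[(k : ℝ) - 1] N = 0 ∧ (∀ i, HasFDerivAt (g i) (L i) 0 ∧ L i ≠ 0) ∧ ∀ c, ‖c‖ < δ → c ≠ 0 → ¬ (∀ 𝒟 : Literature.Geometry.Lorentzian.VacuumCauchyDevelopment (Φ c), 𝒟.IsMaximal → Summit.FinalStateConjecture.HasCompleteNullInfinity 𝒟.toCauchyDevelopment ∧ ∃ (O : Set 𝒟.carrier) (d : Literature.Geometry.Lorentzian.FinalStateDecomposition 𝒟.toSpacetime O 2), (∀ i, Literature.Geometry.Lorentzian.Kerr.IsSubextremal (d.mass i) (d.spin i)) ∧ O = Summit.FinalStateConjecture.exteriorOf 𝒟.toCauchyDevelopment d.charted ∧ Summit.FinalStateConjecture.RaysStayInClosure 𝒟.toCauchyDevelopment O ∧ Summit.FinalStateConjecture.HasExhaustiveCharts d ∧ Summit.FinalStateConjecture.IsFutureOriented d) → c ∈ N ∨ ∃ i, g i c = 0 := by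
    by_cases hC : ∃ 𝒟 : Literature.Geometry.Lorentzian.VacuumCauchyDevelopment D, 𝒟.IsMaximal ∧ ¬ Summit.FinalStateConjecture.HasCompleteNullInfinity 𝒟.toCauchyDevelopment
    · exact h₁ X D hDadm hC
    · refine h₂ X D hDadm ?_ ?_
      · intro 𝒟 h𝒟
        by_contra hc
        exact hC ⟨𝒟, h𝒟, hc⟩
      · by_contra hS
        apply hnotP
        refine ⟨⟨𝒟₀, h𝒟₀⟩, fun 𝒟 h𝒟 ↦ ⟨?_, ?_⟩⟩
        · by_contra hc
          exact hC ⟨𝒟, h𝒟, hc⟩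
        · by_contra hs
          exact hS ⟨𝒟, h𝒟, hs⟩
  obtain ⟨e, k, Φ, hk, htame, himm, hinj, h0, hadm, δ, N, m, g, L, hδ, hN, hgL, hsub⟩ := key
  have hTsub : ∀ c ∈ ({c : EuclideanSpace ℝ (Fin k) | ¬ (∀ 𝒟 : Literature.Geometry.Lorentzian.VacuumCauchyDevelopment (Φ c), 𝒟.IsMaximal → Summit.FinalStateConjecture.HasCompleteNullInfinity 𝒟.toCauchyDevelopment ∧ ∃ (O : Set 𝒟.carrier) (d : Literature.Geometry.Lorentzian.FinalStateDecomposition 𝒟.toSpacetime O 2), (∀ i, Literature.Geometry.Lorentzian.Kerr.IsSubextremal (d.mass i) (d.spin i)) ∧ O = Summit.FinalStateConjecture.exteriorOf 𝒟.toCauchyDevelopment d.charted ∧ Summit.FinalStateConjecture.RaysStayInClosure 𝒟.toCauchyDevelopment O ∧ Summit.FinalStateConjecture.HasExhaustiveCharts d ∧ Summit.FinalStateConjecture.IsFutureOriented d)} : Set (EuclideanSpace ℝ (Fin k))), ‖c‖ < δ → c ≠ 0 → c ∈ N ∨ ∃ i, g i c = 0 :=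
    fun c hc hcδ hc0 ↦ hsub c hcδ hc0 hc
  obtain ⟨θ, hθ, ε, hε, hseg⟩ := h₄ k hk _ N δ m g L hδ hN hgL hTsub
  have hgood : ∀ t : ℝ, t ≠ 0 → |t| < ε → Φ (t • θ) ∉ {d ∈ Literature.Geometry.Lorentzian.admissibleVacuumData X | ¬ ((∃ 𝒟 : Literature.Geometry.Lorentzian.VacuumCauchyDevelopment d, 𝒟.IsMaximal) ∧ ∀ 𝒟 : Literature.Geometry.Lorentzian.VacuumCauchyDevelopment d, 𝒟.IsMaximal → Summit.FinalStateConjecture.HasCompleteNullInfinity 𝒟.toCauchyDevelopment ∧ ∃ (O : Set 𝒟.carrier) (d : Literature.Geometry.Lorentzian.FinalStateDecomposition 𝒟.toSpacetime O 2), (∀ i, Literature.Geometry.Lorentzian.Kerr.IsSubextremal (d.mass i) (d.spin i)) ∧ O = Summit.FinalStateConjecture.exteriorOf 𝒟.toCauchyDevelopment d.charted ∧ Summit.FinalStateConjecture.RaysStayInClosure 𝒟.toCauchyDevelopment O ∧ Summit.FinalStateConjecture.HasExhaustiveCharts d ∧ Summit.FinalStateConjecture.IsFutureOriented d)} := by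
    intro t ht htε hmem
    obtain ⟨-, hnP⟩ := hmem
    apply hnP
    refine ⟨h₃ X _ (hadm _), ?_⟩
    by_contra hP'
    exact hseg t ht htε hP'
  obtain ⟨F, hF, hFimm, hF0, hFinj, hFadm, hFgood⟩ :=
    h₅ X (Literature.Geometry.Lorentzian.admissibleVacuumData X) _ e k Φ θ ε htame himm hinj hadm hθ hε hgood
  exact ⟨e, F, hF, hFimm, hF0.trans h0, hFinj, hFadm, hFgood⟩

/-- **Former frame proof of the rev-3 assembly** (item stmt-FinalStateConjecture-9966, closed `proved`
by this name at rev 3 and replaced at rev 4 by stmt-FinalStateConjecture-17472 after the summit re-type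
p126844). Its statement inlined the rev-3 bodies of `CensorshipTraceNull` / `SettlingTraceNull`
(smooth probes, settled clause without `RaysStayInClosure` / `IsFutureOriented`) and `SegmentToCurve`
and concluded the summit statement; against the re-typed `FinalStateConjecture` that statement is no
longer provable from its own hypotheses and its proof stopped elaborating, so — Theorems files being
append-only (deprecate, don't mutate) — the name is kept as a deprecated alias of the tame frame
proof of the current assembly (see the module docstring, "Repair 2026-08-17"). -/
@[deprecated ProbeNullTrace.assembly_tame_frame_proof (since := "2026-08-17")]
alias ProbeNullTrace.assembly_frame_proof := ProbeNullTrace.assembly_tame_frame_proof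

end Summit.FinalStateConjecture.FinalStateConjecture.Theorems
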